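import Summits.AnomalousDissipation.AnomalousDissipation.Theorems.QuarticGate.Negative.EnergyRow

/-!
# Negative knowledge for the crux `MomentParity.UniformResolution` (stmt-AnomalousDissipation-14330), V:
# an Agmon-type inequality on `T³` with absolute constants (tools for the steady sector)

Certified infrastructure from the cdisprove work files of refuter-cdisprove-stmt-AnomalousDissipation-14330-0
(cycle 1). Supports stmt-AnomalousDissipation-14330; no route-item statement is asserted. Used by
`Negative/SteadyStates.lean` (N-uniform `H²` bound and resolution of Galerkin steady states).

* §1 LATTICE SUMS by dyadic sup-norm shells: `supNorm`, `lvl = ⌊log₂ ‖k‖_∞⌋`, `sum_inv_freqNormSq_sq_le`: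
  `Σ_{k ∈ S, k ≠ 0, lvl k ≥ i₀} |k|⁻⁴ ≤ 128 · 2^{-i₀}` for every finite `S ⊆ ℤ³` (shell `i` has `≤ 64·8^i`
  points, each `≤ 16^{-i}`).
* §2 AGMON, dyadic form (`norm_realTrigPoly_le_agmon`): for a real vector trigonometric polynomial with
  `c 0 = 0`, `‖p(x)‖ ≤ √(384·4^{i₀}) √(Σ|k|²‖c k‖²) + √(128·2^{-i₀}) √(Σ|k|⁴‖c k‖²)` for every cut `i₀`
  (Cauchy–Schwarz on the low/high parts; the classical `‖u‖_∞ ≲ ‖∇u‖^{1/2}‖Δu‖^{1/2}` is the optimised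
  version, not needed downstream).
* §3 `integral_sum_norm_sq_partialDeriv_realTrigPoly` (`∫Σⱼ‖∂ⱼp‖² = 4π²Σ|k|²‖c k‖²`),
  `integral_norm_sq_laplacian_realTrigPoly` (`∫‖Δp‖² = 16π⁴Σ|k|⁴‖c k‖²`), `norm_convect_self_le`,
  `integral_norm_sq_convect_self_le` (`∫‖(p·∇)p‖² ≤ ‖p‖_∞² ∫Σⱼ‖∂ⱼp‖²`).
-/

namespace Summit.AnomalousDissipation.AnomalousDissipation.Theorems.UniformResolution.Negative

open MeasureTheory Filter Topology
open scoped ENNReal InnerProductSpace RealInnerProductSpace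
open Literature.Analysis.FunctionSpaces Literature.Analysis.FluidPDE

noncomputable section

/-! ## 1. Lattice sums: `Σ_{k ≠ 0, ‖k‖_∞ ≥ 2^{i₀}} |k|⁻⁴ ≤ 128 · 2^{-i₀}` by dyadic sup-norm shells -/

section Lattice

/-- The sup-norm `‖k‖_∞ = maxᵢ |kᵢ|` of an integer vector, as a natural number. -/
def supNorm (k : Fin 3 → ℤ) : ℕ := Finset.univ.sup fun i => (k i).natAbs

/-- `natAbs_le_supNorm` (bookkeeping). [folklore] -/
theorem natAbs_le_supNorm (k : Fin 3 → ℤ) (i : Fin 3) : (k i).natAbs ≤ supNorm k :=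
  Finset.le_sup (f := fun i => (k i).natAbs) (Finset.mem_univ i)

/-- `exists_natAbs_eq_supNorm` (bookkeeping). [folklore] -/
theorem exists_natAbs_eq_supNorm (k : Fin 3 → ℤ) : ∃ i, (k i).natAbs = supNorm k := by
  obtain ⟨i, -, hi⟩ := Finset.exists_mem_eq_sup (Finset.univ : Finset (Fin 3)) Finset.univ_nonempty
    (fun i => (k i).natAbs)
  exact ⟨i, hi.symm⟩

/-- `supNorm_pos` (bookkeeping). [folklore] -/
theorem supNorm_pos {k : Fin 3 → ℤ} (hk : k ≠ 0) : 0 < supNorm k := by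
  obtain ⟨i, hi⟩ : ∃ i, k i ≠ 0 := Function.ne_iff.1 hk
  exact (Int.natAbs_pos.2 hi).trans_le (natAbs_le_supNorm k i)

/-- `‖k‖_∞² ≤ |k|²`. [folklore] -/
theorem sq_supNorm_le_freqNormSq (k : Fin 3 → ℤ) : ((supNorm k : ℝ)) ^ 2 ≤ Torus.freqNormSq k := by
  obtain ⟨i, hi⟩ := exists_natAbs_eq_supNorm k
  have h1 : ((supNorm k : ℝ)) ^ 2 = ((k i : ℝ)) ^ 2 := by
    rw [← hi, Nat.cast_natAbs, Int.cast_abs, sq_abs]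
  rw [h1]
  exact Finset.single_le_sum (f := fun j => ((k j : ℝ)) ^ 2) (fun _ _ => sq_nonneg _) (Finset.mem_univ i)

/-- `|k|² ≤ 3 ‖k‖_∞²`. [folklore] -/
theorem freqNormSq_le_three_mul_sq_supNorm (k : Fin 3 → ℤ) :
    Torus.freqNormSq k ≤ 3 * ((supNorm k : ℝ)) ^ 2 := by
  have h : ∀ j, ((k j : ℝ)) ^ 2 ≤ ((supNorm k : ℝ)) ^ 2 := fun j => by
    have h1 : ((k j : ℝ)) ^ 2 = (((k j).natAbs : ℝ)) ^ 2 := by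
      rw [Nat.cast_natAbs, Int.cast_abs, sq_abs]
    rw [h1]
    exact pow_le_pow_left₀ (Nat.cast_nonneg _) (by exact_mod_cast natAbs_le_supNorm k j) 2
  calc Torus.freqNormSq k = ∑ j, ((k j : ℝ)) ^ 2 := rfl
    _ ≤ ∑ _j : Fin 3, ((supNorm k : ℝ)) ^ 2 := Finset.sum_le_sum fun j _ => h j
    _ = 3 * ((supNorm k : ℝ)) ^ 2 := by simp [Finset.sum_const, Finset.card_univ]

/-- The open sup-norm box `{‖k‖_∞ < M}` as a finset. -/
def box (M : ℕ) : Finset (Fin 3 → ℤ) := Fintype.piFinset fun _ => Finset.Ioo (-(M : ℤ)) M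

/-- `mem_box_of_supNorm_lt` (bookkeeping). [folklore] -/
theorem mem_box_of_supNorm_lt {k : Fin 3 → ℤ} {M : ℕ} (h : supNorm k < M) : k ∈ box M := by
  rw [box, Fintype.mem_piFinset]
  intro i
  have hi : (k i).natAbs < M := (natAbs_le_supNorm k i).trans_lt h
  rw [Finset.mem_Ioo]
  omega

/-- `card_box` (bookkeeping). [folklore] -/
theorem card_box (M : ℕ) : (box M).card ≤ (2 * M) ^ 3 := by
  rw [box, Fintype.card_piFinset, Finset.prod_const, Finset.card_univ, Fintype.card_fin]
  gcongr
  rw [Int.card_Ioo]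
  omega

/-- The dyadic sup-norm level `⌊log₂ ‖k‖_∞⌋`. -/
def lvl (k : Fin 3 → ℤ) : ℕ := Nat.log 2 (supNorm k)

/-- `pow_lvl_le` (bookkeeping). [folklore] -/
theorem pow_lvl_le {k : Fin 3 → ℤ} (hk : k ≠ 0) : 2 ^ lvl k ≤ supNorm k :=
  Nat.pow_log_le_self 2 (supNorm_pos hk).ne'

/-- `supNorm_lt_pow_succ` (bookkeeping). [folklore] -/
theorem supNorm_lt_pow_succ (k : Fin 3 → ℤ) : supNorm k < 2 ^ (lvl k + 1) :=
  Nat.lt_pow_succ_log_self (by norm_num) _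

/-- On the dyadic shell of level `i`, `|k|⁻⁴ ≤ 16^{-i}`. [folklore] -/
theorem inv_freqNormSq_sq_le_of_lvl {k : Fin 3 → ℤ} (hk : k ≠ 0) :
    (Torus.freqNormSq k)⁻¹ ^ 2 ≤ ((16 : ℝ) ^ lvl k)⁻¹ := by
  have h1 : ((2 : ℝ) ^ lvl k) ^ 2 ≤ Torus.freqNormSq k := by
    refine le_trans ?_ (sq_supNorm_le_freqNormSq k)
    exact pow_le_pow_left₀ (by positivity) (by exact_mod_cast pow_lvl_le hk) 2
  have h0 : (0 : ℝ) < ((2 : ℝ) ^ lvl k) ^ 2 := by positivity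
  have h16 : (16 : ℝ) ^ lvl k = (((2 : ℝ) ^ lvl k) ^ 2) ^ 2 := by
    rw [← pow_mul, ← pow_mul, show (16 : ℝ) = 2 ^ 4 by norm_num, ← pow_mul]
    ring_nf
  rw [h16, inv_pow]
  exact inv_anti₀ (by positivity) (pow_le_pow_left₀ h0.le h1 2)

/-- **Dyadic lattice bound**: for every finite set of nonzero frequencies at sup-norm levels `≥ i₀`,
`Σ |k|⁻⁴ ≤ 128 · 2^{-i₀}`. [folklore] -/
theorem sum_inv_freqNormSq_sq_le (S : Finset (Fin 3 → ℤ)) (i₀ : ℕ) :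
    ∑ k ∈ S.filter (fun k => k ≠ 0 ∧ i₀ ≤ lvl k), (Torus.freqNormSq k)⁻¹ ^ 2 ≤ 128 * ((2 : ℝ)⁻¹) ^ i₀ := by
  classical
  set S' := S.filter (fun k => k ≠ 0 ∧ i₀ ≤ lvl k) with hS'
  set M : ℕ := S'.sup lvl + 1 with hM
  have hmaps : ∀ k ∈ S', lvl k ∈ Finset.Ico i₀ M := fun k hk => by
    rw [Finset.mem_Ico]
    exact ⟨((Finset.mem_filter.1 hk).2).2, Nat.lt_succ_of_le (Finset.le_sup (f := lvl) hk)⟩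
  rw [← Finset.sum_fiberwise_of_maps_to hmaps]
  have hfiber : ∀ i ∈ Finset.Ico i₀ M,
      ∑ k ∈ S'.filter (fun k => lvl k = i), (Torus.freqNormSq k)⁻¹ ^ 2 ≤ 64 * ((2 : ℝ)⁻¹) ^ i := by
    intro i _
    have hsub : S'.filter (fun k => lvl k = i) ⊆ box (2 ^ (i + 1)) := fun k hk => by
      rw [Finset.mem_filter] at hk
      have := supNorm_lt_pow_succ k
      rw [hk.2] at this
      exact mem_box_of_supNorm_lt this
    have hcard : ((S'.filter (fun k => lvl k = i)).card : ℝ) ≤ 64 * 8 ^ i := by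
      have h1 := (Finset.card_le_card hsub).trans (card_box (2 ^ (i + 1)))
      have h2 : ((2 * 2 ^ (i + 1)) ^ 3 : ℕ) = 64 * 8 ^ i := by
        rw [pow_succ]; ring_nf
        rw [show (8 : ℕ) = 2 ^ 3 by norm_num, ← pow_mul, mul_comm 3 i]
      rw [h2] at h1
      exact_mod_cast h1
    calc ∑ k ∈ S'.filter (fun k => lvl k = i), (Torus.freqNormSq k)⁻¹ ^ 2
        ≤ ∑ _k ∈ S'.filter (fun k => lvl k = i), ((16 : ℝ) ^ i)⁻¹ := by
          refine Finset.sum_le_sum fun k hk => ?_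
          rw [Finset.mem_filter] at hk
          have hk0 : k ≠ 0 := ((Finset.mem_filter.1 hk.1).2).1
          rw [← hk.2]
          exact inv_freqNormSq_sq_le_of_lvl hk0
      _ = ((S'.filter (fun k => lvl k = i)).card : ℝ) * ((16 : ℝ) ^ i)⁻¹ := by
          rw [Finset.sum_const, nsmul_eq_mul]
      _ ≤ (64 * 8 ^ i) * ((16 : ℝ) ^ i)⁻¹ := by gcongr
      _ = 64 * ((2 : ℝ)⁻¹) ^ i := by
          rw [show (16 : ℝ) = 8 * 2 by norm_num, mul_pow, mul_inv, inv_pow]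
          field_simp
  calc ∑ i ∈ Finset.Ico i₀ M, ∑ k ∈ S'.filter (fun k => lvl k = i), (Torus.freqNormSq k)⁻¹ ^ 2
      ≤ ∑ i ∈ Finset.Ico i₀ M, 64 * ((2 : ℝ)⁻¹) ^ i := Finset.sum_le_sum hfiber
    _ = 64 * ∑ i ∈ Finset.Ico i₀ M, ((2 : ℝ)⁻¹) ^ i := by rw [Finset.mul_sum]
    _ ≤ 64 * (((2 : ℝ)⁻¹) ^ i₀ / (1 - 2⁻¹)) := by
        gcongr
        exact geom_sum_Ico_le_of_lt_one (by norm_num) (by norm_num)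
    _ = 128 * ((2 : ℝ)⁻¹) ^ i₀ := by ring

end Lattice

/-! ## 2. An Agmon-type inequality for real trigonometric polynomials on `T³` (absolute constants) -/

section Agmon

/-- Cauchy–Schwarz with square roots: `Σ fg ≤ √(Σ f²) √(Σ g²)`. [folklore] -/
theorem sum_mul_le_sqrt_mul_sqrt {ι : Type*} (s : Finset ι) (f g : ι → ℝ) :
    ∑ i ∈ s, f i * g i ≤ Real.sqrt (∑ i ∈ s, f i ^ 2) * Real.sqrt (∑ i ∈ s, g i ^ 2) := by
  rw [← Real.sqrt_mul (Finset.sum_nonneg fun i _ => sq_nonneg (f i))]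
  exact (le_abs_self _).trans (Real.abs_le_sqrt (Finset.sum_mul_sq_le_sq_mul_sq s f g))

/-- Low frequencies: `Σ_{k ≠ 0, lvl k < i₀} |k|⁻² ≤ 384 · 4^{i₀}`. [folklore] -/
theorem sum_inv_freqNormSq_low_le (S : Finset (Fin 3 → ℤ)) (i₀ : ℕ) :
    ∑ k ∈ S.filter (fun k => k ≠ 0 ∧ lvl k < i₀), (Torus.freqNormSq k)⁻¹ ≤ 384 * (4 : ℝ) ^ i₀ := by
  classical
  have hpt : ∀ k ∈ S.filter (fun k => k ≠ 0 ∧ lvl k < i₀),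
      (Torus.freqNormSq k)⁻¹ ≤ 3 * (4 : ℝ) ^ i₀ * (Torus.freqNormSq k)⁻¹ ^ 2 := by
    intro k hk
    obtain ⟨hk0, hki⟩ := (Finset.mem_filter.1 hk).2
    have hq0 : 0 < Torus.freqNormSq k := lt_of_lt_of_le one_pos (Torus.one_le_freqNormSq hk0)
    have hsup : (supNorm k : ℝ) < 2 ^ i₀ := by
      have h1 := supNorm_lt_pow_succ k
      have h2 : 2 ^ (lvl k + 1) ≤ 2 ^ i₀ := Nat.pow_le_pow_right (by norm_num) hki
      exact_mod_cast h1.trans_le h2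
    have hq : Torus.freqNormSq k ≤ 3 * (4 : ℝ) ^ i₀ := by
      refine (freqNormSq_le_three_mul_sq_supNorm k).trans ?_
      rw [show (4 : ℝ) ^ i₀ = ((2 : ℝ) ^ i₀) ^ 2 by rw [← pow_mul, mul_comm, pow_mul]; norm_num]
      gcongr
    calc (Torus.freqNormSq k)⁻¹ = Torus.freqNormSq k * (Torus.freqNormSq k)⁻¹ ^ 2 := by
          field_simp
      _ ≤ 3 * (4 : ℝ) ^ i₀ * (Torus.freqNormSq k)⁻¹ ^ 2 := by gcongr
  calc ∑ k ∈ S.filter (fun k => k ≠ 0 ∧ lvl k < i₀), (Torus.freqNormSq k)⁻¹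
      ≤ ∑ k ∈ S.filter (fun k => k ≠ 0 ∧ lvl k < i₀), 3 * (4 : ℝ) ^ i₀ * (Torus.freqNormSq k)⁻¹ ^ 2 :=
        Finset.sum_le_sum hpt
    _ = 3 * (4 : ℝ) ^ i₀ * ∑ k ∈ S.filter (fun k => k ≠ 0 ∧ lvl k < i₀), (Torus.freqNormSq k)⁻¹ ^ 2 := by
        rw [Finset.mul_sum]
    _ ≤ 3 * (4 : ℝ) ^ i₀ * ∑ k ∈ S.filter (fun k => k ≠ 0 ∧ 0 ≤ lvl k), (Torus.freqNormSq k)⁻¹ ^ 2 := by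
        refine mul_le_mul_of_nonneg_left ?_ (by positivity)
        refine Finset.sum_le_sum_of_subset_of_nonneg (fun k hk => ?_) fun _ _ _ => by positivity
        rw [Finset.mem_filter] at hk ⊢
        exact ⟨hk.1, hk.2.1, Nat.zero_le _⟩
    _ ≤ 3 * (4 : ℝ) ^ i₀ * (128 * ((2 : ℝ)⁻¹) ^ 0) :=
        mul_le_mul_of_nonneg_left (sum_inv_freqNormSq_sq_le S 0) (by positivity)
    _ = 384 * (4 : ℝ) ^ i₀ := by ring

/-- **Agmon-type inequality on `T³`, dyadic form.** For a real vector trigonometric polynomial with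
coefficients `c` on a finite frequency set `S` and `c 0 = 0`, and every dyadic cut `i₀`,
`‖p(x)‖ ≤ √(384·4^{i₀}) · √(Σ |k|²‖c k‖²) + √(128·2^{-i₀}) · √(Σ |k|⁴‖c k‖²)`
(split `Σ‖c k‖` at sup-norm level `i₀`, Cauchy–Schwarz, and the lattice bounds of §1). [folklore] -/
theorem norm_realTrigPoly_le_agmon (S : Finset (Fin 3 → ℤ)) {c : (Fin 3 → ℤ) → EuclideanSpace ℂ (Fin 3)}
    (hc0 : c 0 = 0) (i₀ : ℕ) (x : UnitAddTorus (Fin 3)) :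
    ‖Torus.realTrigPoly S c x‖ ≤
      Real.sqrt (384 * (4 : ℝ) ^ i₀) * Real.sqrt (∑ k ∈ S, Torus.freqNormSq k * ‖c k‖ ^ 2) +
        Real.sqrt (128 * ((2 : ℝ)⁻¹) ^ i₀) * Real.sqrt (∑ k ∈ S, Torus.freqNormSq k ^ 2 * ‖c k‖ ^ 2) := by
  classical
  set Slow := S.filter (fun k => k ≠ 0 ∧ lvl k < i₀) with hSlow
  set Shigh := S.filter (fun k => k ≠ 0 ∧ i₀ ≤ lvl k) with hShigh
  -- drop the zero mode and split
  have hsplit : ∑ k ∈ S, ‖c k‖ = ∑ k ∈ Slow, ‖c k‖ + ∑ k ∈ Shigh, ‖c k‖ := by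
    have h1 : ∑ k ∈ S, ‖c k‖ = ∑ k ∈ S.filter (fun k => k ≠ 0), ‖c k‖ := by
      refine (Finset.sum_filter_of_ne fun k _ hk => ?_).symm
      intro h0
      exact hk (by rw [h0, hc0, norm_zero])
    have h2 := (Finset.sum_filter_add_sum_filter_not (S.filter fun k => k ≠ 0) (fun k => lvl k < i₀)
      (fun k => ‖c k‖)).symm
    rw [Finset.filter_filter, Finset.filter_filter] at h2
    have h3 : S.filter (fun k => k ≠ 0 ∧ ¬ lvl k < i₀) = Shigh :=
      Finset.filter_congr fun k _ => by simp only [not_lt]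
    rw [h1, h2, h3]
  -- low part
  have hlow : ∑ k ∈ Slow, ‖c k‖ ≤
      Real.sqrt (384 * (4 : ℝ) ^ i₀) * Real.sqrt (∑ k ∈ S, Torus.freqNormSq k * ‖c k‖ ^ 2) := by
    have h1 : ∑ k ∈ Slow, ‖c k‖ = ∑ k ∈ Slow,
        Real.sqrt ((Torus.freqNormSq k)⁻¹) * Real.sqrt (Torus.freqNormSq k * ‖c k‖ ^ 2) := by
      refine Finset.sum_congr rfl fun k hk => ?_
      obtain ⟨hk0, -⟩ := (Finset.mem_filter.1 hk).2
      have hq0 : 0 < Torus.freqNormSq k := lt_of_lt_of_le one_pos (Torus.one_le_freqNormSq hk0)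
      rw [← Real.sqrt_mul (inv_nonneg.2 hq0.le), ← mul_assoc, inv_mul_cancel₀ hq0.ne', one_mul,
        Real.sqrt_sq (norm_nonneg _)]
    rw [h1]
    refine (sum_mul_le_sqrt_mul_sqrt Slow _ _).trans ?_
    gcongr
    · simp_rw [Real.sq_sqrt (inv_nonneg.2 (Torus.freqNormSq_nonneg _))]
      exact sum_inv_freqNormSq_low_le S i₀
    · simp_rw [Real.sq_sqrt (mul_nonneg (Torus.freqNormSq_nonneg _) (sq_nonneg _))]
      exact Finset.sum_le_sum_of_subset_of_nonneg (Finset.filter_subset _ _)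
        fun k _ _ => mul_nonneg (Torus.freqNormSq_nonneg _) (sq_nonneg _)
  -- high part
  have hhigh : ∑ k ∈ Shigh, ‖c k‖ ≤
      Real.sqrt (128 * ((2 : ℝ)⁻¹) ^ i₀) * Real.sqrt (∑ k ∈ S, Torus.freqNormSq k ^ 2 * ‖c k‖ ^ 2) := by
    have h1 : ∑ k ∈ Shigh, ‖c k‖ = ∑ k ∈ Shigh,
        Real.sqrt ((Torus.freqNormSq k)⁻¹ ^ 2) * Real.sqrt (Torus.freqNormSq k ^ 2 * ‖c k‖ ^ 2) := by
      refine Finset.sum_congr rfl fun k hk => ?_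
      obtain ⟨hk0, -⟩ := (Finset.mem_filter.1 hk).2
      have hq0 : 0 < Torus.freqNormSq k := lt_of_lt_of_le one_pos (Torus.one_le_freqNormSq hk0)
      rw [← Real.sqrt_mul (sq_nonneg _), ← mul_assoc, ← mul_pow, inv_mul_cancel₀ hq0.ne', one_pow,
        one_mul, Real.sqrt_sq (norm_nonneg _)]
    rw [h1]
    refine (sum_mul_le_sqrt_mul_sqrt Shigh _ _).trans ?_
    gcongr
    · simp_rw [Real.sq_sqrt (sq_nonneg _)]
      exact sum_inv_freqNormSq_sq_le S i₀
    · simp_rw [Real.sq_sqrt (mul_nonneg (sq_nonneg _) (sq_nonneg _))]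
      exact Finset.sum_le_sum_of_subset_of_nonneg (Finset.filter_subset _ _)
        fun k _ _ => mul_nonneg (sq_nonneg _) (sq_nonneg _)
  calc ‖Torus.realTrigPoly S c x‖ ≤ ∑ k ∈ S, ‖c k‖ := Torus.norm_realTrigPoly_apply_le S c x
    _ = ∑ k ∈ Slow, ‖c k‖ + ∑ k ∈ Shigh, ‖c k‖ := hsplit
    _ ≤ _ := add_le_add hlow hhigh

end Agmon

/-! ## 3. Norms of derivatives of real trigonometric polynomials; the convection bound -/

section TrigNorms

variable {S : Finset (Fin 3 → ℤ)} {c : (Fin 3 → ℤ) → EuclideanSpace ℂ (Fin 3)}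

/-- `‖(2πi kⱼ) • v‖² = 4π² kⱼ² ‖v‖²`. [folklore] -/
theorem norm_sq_deriv_coeff (k : Fin 3 → ℤ) (j : Fin 3) (v : EuclideanSpace ℂ (Fin 3)) :
    ‖(2 * Real.pi * Complex.I * (k j)) • v‖ ^ 2 = 4 * Real.pi ^ 2 * ((k j : ℝ)) ^ 2 * ‖v‖ ^ 2 := by
  rw [norm_smul, mul_pow]
  congr 1
  rw [show (2 * Real.pi * Complex.I * (k j) : ℂ) = ((2 * Real.pi * (k j : ℝ) : ℝ) : ℂ) * Complex.I by
    push_cast; ring, norm_mul, Complex.norm_I, mul_one, Complex.norm_real, Real.norm_eq_abs, sq_abs]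
  ring

/-- **Hilbert–Schmidt gradient norm of a real trigonometric polynomial**:
`∫ Σⱼ ‖∂ⱼ p‖² = 4π² Σₖ |k|² ‖c k‖²`. [folklore] -/
theorem integral_sum_norm_sq_partialDeriv_realTrigPoly (hS : ∀ k ∈ S, -k ∈ S) (hc : Torus.IsConjSymm c) :
    ∫ x, ∑ j, ‖Torus.partialDeriv j (Torus.realTrigPoly S c) x‖ ^ 2 =
      4 * Real.pi ^ 2 * ∑ k ∈ S, Torus.freqNormSq k * ‖c k‖ ^ 2 := by
  rw [integral_finsetSum _ fun j _ => ?_]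
  · simp_rw [Torus.partialDeriv_realTrigPoly']
    have h : ∀ j : Fin 3, ∫ x, ‖Torus.realTrigPoly S (fun k => (2 * Real.pi * Complex.I * (k j)) • c k) x‖ ^ 2 =
        ∑ k ∈ S, 4 * Real.pi ^ 2 * ((k j : ℝ)) ^ 2 * ‖c k‖ ^ 2 := fun j => by
      rw [Torus.integral_norm_sq_realTrigPoly hS (hc.deriv j)]
      exact Finset.sum_congr rfl fun k _ => norm_sq_deriv_coeff k j (c k)
    simp_rw [h]
    rw [Finset.sum_comm, Finset.mul_sum]
    refine Finset.sum_congr rfl fun k _ => ?_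
    rw [Torus.freqNormSq, Finset.sum_mul, Finset.mul_sum]
    refine Finset.sum_congr rfl fun j _ => ?_
    ring
  · simp_rw [Torus.partialDeriv_realTrigPoly']
    exact ((Torus.continuous_realTrigPoly _ _).norm.pow 2).integrable_unitAddTorus

/-- The Laplacian coefficients `−4π²|k|² c k` are conjugate-symmetric when `c` is. [folklore] -/
theorem isConjSymm_lapCoeff (hc : Torus.IsConjSymm c) :
    Torus.IsConjSymm (fun k : Fin 3 → ℤ => -((((4 * Real.pi ^ 2 * Torus.freqNormSq k : ℝ)) : ℂ) • c k)) := by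
  intro k
  dsimp only
  rw [EuclideanSpace.conjVec_neg, EuclideanSpace.conjVec_smul, Complex.conj_ofReal, hc k,
    Torus.freqNormSq_neg]

/-- **`L²` norm of the Laplacian of a real trigonometric polynomial**: `∫ ‖Δp‖² = 16π⁴ Σₖ |k|⁴ ‖c k‖²`. [folklore] -/
theorem integral_norm_sq_laplacian_realTrigPoly (hS : ∀ k ∈ S, -k ∈ S) (hc : Torus.IsConjSymm c) :
    ∫ x, ‖Torus.laplacian (Torus.realTrigPoly S c) x‖ ^ 2 =
      16 * Real.pi ^ 4 * ∑ k ∈ S, Torus.freqNormSq k ^ 2 * ‖c k‖ ^ 2 := by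
  simp_rw [Torus.laplacian_realTrigPoly]
  rw [Torus.integral_norm_sq_realTrigPoly hS (isConjSymm_lapCoeff hc), Finset.mul_sum]
  refine Finset.sum_congr rfl fun k _ => ?_
  have hq : 0 ≤ Torus.freqNormSq k := Torus.freqNormSq_nonneg k
  rw [norm_neg, norm_smul, Complex.norm_real, Real.norm_eq_abs,
    abs_of_nonneg (by positivity : (0 : ℝ) ≤ 4 * Real.pi ^ 2 * Torus.freqNormSq k)]
  ring

/-- **Pointwise convection bound**: `‖(p·∇)p (x)‖ ≤ ‖p x‖ · (Σⱼ ‖∂ⱼp x‖²)^{1/2}`. [folklore] -/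
theorem norm_convect_self_le {p : UnitAddTorus (Fin 3) → EuclideanSpace ℝ (Fin 3)} (hp : Torus.IsSmooth p)
    (x : UnitAddTorus (Fin 3)) :
    ‖Torus.convect p p x‖ ≤ ‖p x‖ * Real.sqrt (∑ j, ‖Torus.partialDeriv j p x‖ ^ 2) := by
  rw [Torus.convect, Torus.fderiv_apply_eq_sum_partialDeriv (hp.isContDiff (by simp))]
  calc ‖∑ j, p x j • Torus.partialDeriv j p x‖ ≤ ∑ j, ‖p x j • Torus.partialDeriv j p x‖ := norm_sum_le _ _
    _ = ∑ j, |p x j| * ‖Torus.partialDeriv j p x‖ := by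
        refine Finset.sum_congr rfl fun j _ => ?_
        rw [norm_smul, Real.norm_eq_abs]
    _ ≤ Real.sqrt (∑ j, |p x j| ^ 2) * Real.sqrt (∑ j, ‖Torus.partialDeriv j p x‖ ^ 2) :=
        sum_mul_le_sqrt_mul_sqrt _ _ _
    _ = ‖p x‖ * Real.sqrt (∑ j, ‖Torus.partialDeriv j p x‖ ^ 2) := by
        rw [EuclideanSpace.norm_eq (p x)]
        simp only [Real.norm_eq_abs]

/-- **Integrated convection bound**: if `‖p‖_∞ ≤ A` then `∫ ‖(p·∇)p‖² ≤ A² ∫ Σⱼ ‖∂ⱼ p‖²`. [folklore] -/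
theorem integral_norm_sq_convect_self_le {p : UnitAddTorus (Fin 3) → EuclideanSpace ℝ (Fin 3)}
    (hp : Torus.IsSmooth p) {A : ℝ} (hA : ∀ x, ‖p x‖ ≤ A) :
    ∫ x, ‖Torus.convect p p x‖ ^ 2 ≤ A ^ 2 * ∫ x, ∑ j, ‖Torus.partialDeriv j p x‖ ^ 2 := by
  have hA0 : 0 ≤ A := (norm_nonneg _).trans (hA 0)
  rw [← integral_const_mul]
  refine integral_mono_of_nonneg (ae_of_all _ fun x => by positivity) ?_ (ae_of_all _ fun x => ?_)
  · refine Integrable.const_mul ?_ _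
    exact (continuous_finsetSum _ fun j _ =>
      ((hp.partialDeriv j).continuous.norm.pow 2)).integrable_unitAddTorus
  · have h := norm_convect_self_le hp x
    have hs : 0 ≤ Real.sqrt (∑ j, ‖Torus.partialDeriv j p x‖ ^ 2) := Real.sqrt_nonneg _
    calc ‖Torus.convect p p x‖ ^ 2 ≤ (‖p x‖ * Real.sqrt (∑ j, ‖Torus.partialDeriv j p x‖ ^ 2)) ^ 2 :=
          pow_le_pow_left₀ (norm_nonneg _) h 2
      _ ≤ (A * Real.sqrt (∑ j, ‖Torus.partialDeriv j p x‖ ^ 2)) ^ 2 := by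
          gcongr
          exact hA x
      _ = A ^ 2 * ∑ j, ‖Torus.partialDeriv j p x‖ ^ 2 := by
          rw [mul_pow, Real.sq_sqrt (Finset.sum_nonneg fun j _ => sq_nonneg _)]

end TrigNorms

end

end Summit.AnomalousDissipation.AnomalousDissipation.Theorems.UniformResolution.Negative
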